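import Literature.Analysis.OperatorTheory.LionsProjection
import Literature.Analysis.OperatorTheory.LionsProjectionRCLike
import Mathlib.Analysis.InnerProductSpace.Projection.Basic
import HarnessLib

/-!
# Lions' projection theorem, operator form: the CANONICAL weak solution is a bounded LINEAR solution operator; a
# uniqueness criterion by approximation from the test space

`Literature/Analysis/OperatorTheory`; proofs-layer file (theorems only; no definitions, no named facts), in the real, bilinear-form
keyed setting of `LionsProjection.lean` (`exists_eq_of_coercive`): `F` a real Hilbert space, `Φ` a real vector space of «test
elements» with a linear `j : Φ → F` and a size function `q ≥ 0`, `‖j φ‖ ≤ C q(φ)`; a bilinear `E : F → Φ → ℝ`, continuous in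
`u ∈ F` for each FIXED `φ` (nothing is asked jointly — this is the point: a differential operator that is NOT bounded on the
energy space `F` still acts continuously on `u` once the test element is frozen), and coercive on the test space,
`α q(φ)² ≤ E(j φ, φ)`.  Lions' theorem gives, for every linear `L` with `|L φ| ≤ C_L q(φ)`, SOME `u ∈ F` with `E(u, ·) = L`
(uniqueness fails in this generality).  This file adds what a certificate needs in order to speak of «the inverse»:

* §1 `exists_representer` — the Riesz representers `K : Φ →ₗ F`, `E(u, φ) = ⟪K φ, u⟫`.
* §2 `eq_of_mem_closure_range` — weak solutions are UNIQUE INSIDE `M := closure (range K)` (a solution of the homogeneous problem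
  is orthogonal to `range K`); `exists_mem_closure_range` — and EXIST there, with Lions' bound `‖u‖ ≤ C_L·C/α` (project any Lions
  solution onto `M`: the equations survive because `K φ ∈ M`, the norm only drops).
* §3 **`exists_solutionOperator_of_coercive`** — hence for a normed data space `W` paired to the tests by a bilinear
  `P : W → Φ → ℝ` with `|P g φ| ≤ C_P‖g‖q(φ)` there is a bounded LINEAR map **`S : W →L[ℝ] F` with `E(S g, φ) = P g φ` for all
  `g, φ` and `‖S g‖ ≤ C_P (C/α)‖g‖`** — no uniqueness hypothesis is needed for this.
* §4 **`eq_zero_of_approx`** — the UNIQUENESS CRITERION met in practice by cutoffs/mollifiers: if `E(u, ·) = 0` and there are test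
  elements `φₙ` with `j φₙ → u` and `E(u, φₙ) − E(j φₙ, φₙ) → 0` («the commutator with the approximation vanishes»), then `u = 0`
  (`α q(φₙ)² ≤ E(jφₙ, φₙ) → 0` forces `j φₙ → 0`); `eq_of_approx` (two weak solutions agree) and `eq_solutionOperator_of_approx` /
  `norm_le_of_approx` (under the criterion every weak solution IS `S g` and obeys the a-priori bound).

[cite: LionsMagenes1972, Chap. 3 Thm. 1.1 and Remark 1.3 (Lions' theorem)] (Lions 1961, Chap. III Thm. 1.1; Showalter 1997, Thm. III.2.1
for the operator reading).  Typical instance (provenance only; nothing below depends on it): `F` an energy Hilbert space `E` of a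
1-D linearised profile operator `𝒜` whose first-order part `½ξ∂_ξ` is unbounded on `E × E`, `Φ` = compactly supported energy-class
test functions, `W = L²_w`, `P g φ = ∫ w g φ` (cell ns-blowup, Z3-SR-CERT MODEL ASSEMBLY: the `S : W →L[ℝ] E` of
`CertificateViscousSheetR.existsUnique_fixedPoint_of_row_w`; Z3-SR-SPEC item (P1)).  WHAT THIS IS NOT: nothing about Navier–Stokes;
abstract functional analysis.
-/

noncomputable section

open scoped RealInnerProductSpace
open Filter Topology

namespace Literature.Analysis.OperatorTheory

variable {F : Type*} [NormedAddCommGroup F] [InnerProductSpace ℝ F]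
  {Φ : Type*} [AddCommGroup Φ] [Module ℝ Φ]

/-! ### §1 Riesz representers of the test functionals -/

/-- **Representers.** If `E : F → Φ → ℝ` is bilinear and `u ↦ E(u, φ)` is bounded for each fixed `φ`, there is a LINEAR
`K : Φ → F` with `E(u, φ) = ⟪K φ, u⟫` (Riesz; linearity by uniqueness of the representation).
[cite: LionsMagenes1972, Chap. 3 Thm. 1.1 (proof)] -/
theorem exists_representer [CompleteSpace F] (E : F →ₗ[ℝ] Φ →ₗ[ℝ] ℝ) (hE : ∀ φ, ∃ K : ℝ, ∀ u, |E u φ| ≤ K * ‖u‖) :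
    ∃ K : Φ →ₗ[ℝ] F, ∀ u φ, E u φ = ⟪K φ, u⟫ := by
  classical
  have hEclm : ∀ φ, ∃ f : F →L[ℝ] ℝ, ∀ u, f u = E u φ := by
    intro φ
    obtain ⟨K, hK⟩ := hE φ
    refine ⟨LinearMap.mkContinuous (E.flip φ) (max K 0) fun u ↦ ?_, fun u ↦ rfl⟩
    rw [Real.norm_eq_abs]
    exact (hK u).trans (mul_le_mul_of_nonneg_right (le_max_left _ _) (norm_nonneg _))
  choose f hf using hEclm
  set K : Φ → F := fun φ ↦ (InnerProductSpace.toDual ℝ F).symm (f φ) with hKdef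
  have hKE : ∀ φ u, E u φ = ⟪K φ, u⟫ := by
    intro φ u
    rw [hKdef, InnerProductSpace.toDual_symm_apply, hf]
  have hK_add : ∀ φ ψ, K (φ + ψ) = K φ + K ψ := by
    intro φ ψ
    refine ext_inner_right ℝ fun u ↦ ?_
    rw [inner_add_left, ← hKE, ← hKE, ← hKE, map_add]
  have hK_smul : ∀ (c : ℝ) φ, K (c • φ) = c • K φ := by
    intro c φ
    refine ext_inner_right ℝ fun u ↦ ?_
    rw [inner_smul_left, ← hKE, ← hKE, map_smul]
    simp
  exact ⟨{ toFun := K, map_add' := hK_add, map_smul' := hK_smul }, fun u φ => hKE φ u⟩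

/-! ### §2 Existence and uniqueness INSIDE the closure of the range of the representers -/

/-- **Uniqueness in `M = closure (range K)`.** Two elements of `M` with the same pairings against every `K φ` coincide
(their difference is orthogonal to `range K`, hence to its closure, hence to itself). [cite: LionsMagenes1972, Chap. 3 Thm. 1.1 and Remark 1.3 (Lions' theorem)] -/
theorem eq_of_mem_closure_range (K : Φ →ₗ[ℝ] F) {u v : F} (hu : u ∈ (LinearMap.range K).topologicalClosure)
    (hv : v ∈ (LinearMap.range K).topologicalClosure) (h : ∀ φ, ⟪K φ, u⟫ = ⟪K φ, v⟫) : u = v := by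
  set R : Submodule ℝ F := LinearMap.range K with hR
  have hd : u - v ∈ R.topologicalClosure := Submodule.sub_mem _ hu hv
  -- `u − v` is orthogonal to `range K`
  have hperp : u - v ∈ Rᗮ := by
    rw [Submodule.mem_orthogonal]
    rintro x ⟨φ, rfl⟩
    rw [inner_sub_right, h φ, sub_self]
  -- `closure (range K) ≤ (range K)ᗮᗮ`
  have hle : R.topologicalClosure ≤ Rᗮᗮ :=
    R.topologicalClosure_minimal R.le_orthogonal_orthogonal (Submodule.isClosed_orthogonal _)
  have h0 : ⟪u - v, u - v⟫ = 0 := Submodule.inner_right_of_mem_orthogonal hperp (hle hd)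
  rwa [real_inner_self_eq_norm_sq, sq_eq_zero_iff, norm_eq_zero, sub_eq_zero] at h0

/-- **Existence in `M = closure (range K)` with Lions' bound.** Under Lions' hypotheses (`‖j φ‖ ≤ C q φ`, `C ≥ 0`, `q ≥ 0`,
`E(u, φ) = ⟪K φ, u⟫`, `α q(φ)² ≤ E(j φ, φ)`, `α > 0`) every linear `L` with `|L φ| ≤ C_L q(φ)` (`C_L ≥ 0`) is `E(u, ·)` for some
`u ∈ closure (range K)` with `‖u‖ ≤ C_L (C/α)` (project any Lions solution onto the closure). [cite: LionsMagenes1972, Chap. 3 Thm. 1.1 and Remark 1.3 (Lions' theorem)] -/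
theorem exists_mem_closure_range [CompleteSpace F] (j : Φ →ₗ[ℝ] F) (q : Φ → ℝ) (hq : ∀ φ, 0 ≤ q φ) {C : ℝ} (hC : 0 ≤ C)
    (hj : ∀ φ, ‖j φ‖ ≤ C * q φ) (E : F →ₗ[ℝ] Φ →ₗ[ℝ] ℝ) (K : Φ →ₗ[ℝ] F) (hK : ∀ u φ, E u φ = ⟪K φ, u⟫)
    {α : ℝ} (hα : 0 < α) (hcoer : ∀ φ, α * q φ ^ 2 ≤ E (j φ) φ) (L : Φ →ₗ[ℝ] ℝ) {CL : ℝ} (hCL : 0 ≤ CL)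
    (hL : ∀ φ, |L φ| ≤ CL * q φ) :
    ∃ u ∈ (LinearMap.range K).topologicalClosure, (∀ φ, E u φ = L φ) ∧ ‖u‖ ≤ CL * (C / α) := by
  set M : Submodule ℝ F := (LinearMap.range K).topologicalClosure with hM
  haveI : CompleteSpace M := (Submodule.isClosed_topologicalClosure _).completeSpace_coe
  -- a Lions solution with the bound (the tree's Riesz-keyed form over `ℝ`)
  have hcoer' : ∀ φ, α * q φ ^ 2 ≤ ‖⟪j φ, K φ⟫‖ := fun φ => by
    rw [real_inner_comm, ← hK, Real.norm_eq_abs]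
    exact (hcoer φ).trans (le_abs_self _)
  have hL' : ∀ φ, ‖L φ‖ ≤ CL * q φ := fun φ => by rw [Real.norm_eq_abs]; exact hL φ
  obtain ⟨u₀, hu₀, hu₀n⟩ := exists_inner_eq_of_coercive (𝕜 := ℝ) j q hq hC hj K hα hcoer' L hCL hL'
  -- project onto `M`
  refine ⟨M.starProjection u₀, M.starProjection_apply_mem u₀, fun φ => ?_, (M.norm_starProjection_apply_le u₀).trans hu₀n⟩
  have hKφ : K φ ∈ M := Submodule.le_topologicalClosure _ (LinearMap.mem_range_self K φ)
  have horth : ⟪u₀ - M.starProjection u₀, K φ⟫ = 0 := M.starProjection_inner_eq_zero u₀ (K φ) hKφ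
  rw [hK, real_inner_comm, ← hu₀ φ]
  rw [inner_sub_left, sub_eq_zero] at horth
  exact horth.symm

/-! ### §3 The bounded linear solution operator -/

/-- **Lions' theorem, operator form.**  `F` a real Hilbert space; `j : Φ → F` linear, `q ≥ 0` with `‖j φ‖ ≤ C q(φ)` (`C ≥ 0`);
`E : F → Φ → ℝ` bilinear with `|E(u, φ)| ≤ K(φ)‖u‖` and `α q(φ)² ≤ E(j φ, φ)` (`α > 0`); `W` a real normed space and
`P : W → Φ → ℝ` bilinear with `|P g φ| ≤ C_P‖g‖·q(φ)` (`C_P ≥ 0`).  Then there is a bounded LINEAR map `S : W →L[ℝ] F` with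
**`E(S g, φ) = P g φ`** for all `g, φ` and **`‖S g‖ ≤ C_P (C/α)‖g‖`** — the canonical weak solution (the unique one in the closure of the
range of the representers) depends linearly on the data. [cite: LionsMagenes1972, Chap. 3 Thm. 1.1 and Remark 1.3 (Lions' theorem)] -/
theorem exists_solutionOperator_of_coercive [CompleteSpace F] (j : Φ →ₗ[ℝ] F) (q : Φ → ℝ) (hq : ∀ φ, 0 ≤ q φ) {C : ℝ} (hC : 0 ≤ C)
    (hj : ∀ φ, ‖j φ‖ ≤ C * q φ) (E : F →ₗ[ℝ] Φ →ₗ[ℝ] ℝ) (hE : ∀ φ, ∃ K : ℝ, ∀ u, |E u φ| ≤ K * ‖u‖)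
    {α : ℝ} (hα : 0 < α) (hcoer : ∀ φ, α * q φ ^ 2 ≤ E (j φ) φ)
    {W : Type*} [NormedAddCommGroup W] [NormedSpace ℝ W] (P : W →ₗ[ℝ] Φ →ₗ[ℝ] ℝ) {CP : ℝ} (hCP : 0 ≤ CP)
    (hP : ∀ g φ, |P g φ| ≤ CP * ‖g‖ * q φ) :
    ∃ S : W →L[ℝ] F, (∀ g φ, E (S g) φ = P g φ) ∧ ∀ g, ‖S g‖ ≤ CP * (C / α) * ‖g‖ := by
  obtain ⟨K, hK⟩ := exists_representer E hE
  set M : Submodule ℝ F := (LinearMap.range K).topologicalClosure with hM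
  have hex : ∀ g : W, ∃ u : F, u ∈ M ∧ (∀ φ, E u φ = P g φ) ∧ ‖u‖ ≤ CP * ‖g‖ * (C / α) := by
    intro g
    obtain ⟨u, huM, hu, hun⟩ := exists_mem_closure_range j q hq hC hj E K hK hα hcoer (P g) (CL := CP * ‖g‖)
      (by positivity) (fun φ => hP g φ)
    exact ⟨u, huM, hu, hun⟩
  choose S₀ hS₀M hS₀E hS₀n using hex
  -- uniqueness inside `M` makes the canonical choice linear
  have huniq : ∀ g u, u ∈ M → (∀ φ, E u φ = P g φ) → u = S₀ g := fun g u huM hu =>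
    eq_of_mem_closure_range K huM (hS₀M g) fun φ => by rw [← hK, ← hK, hu, hS₀E]
  have hadd : ∀ g₁ g₂, S₀ (g₁ + g₂) = S₀ g₁ + S₀ g₂ := fun g₁ g₂ =>
    (huniq (g₁ + g₂) (S₀ g₁ + S₀ g₂) (M.add_mem (hS₀M _) (hS₀M _)) fun φ => by
      rw [map_add, LinearMap.add_apply, hS₀E, hS₀E, map_add, LinearMap.add_apply]).symm
  have hsmul : ∀ (c : ℝ) g, S₀ (c • g) = c • S₀ g := fun c g =>
    (huniq (c • g) (c • S₀ g) (M.smul_mem c (hS₀M _)) fun φ => by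
      rw [map_smul, LinearMap.smul_apply, hS₀E, map_smul, LinearMap.smul_apply]).symm
  set Sₗ : W →ₗ[ℝ] F := { toFun := S₀, map_add' := hadd, map_smul' := hsmul } with hSₗ
  have hbound : ∀ g, ‖Sₗ g‖ ≤ CP * (C / α) * ‖g‖ := fun g =>
    calc ‖Sₗ g‖ = ‖S₀ g‖ := rfl
      _ ≤ CP * ‖g‖ * (C / α) := hS₀n g
      _ = CP * (C / α) * ‖g‖ := by ring
  exact ⟨LinearMap.mkContinuous Sₗ (CP * (C / α)) hbound, fun g φ => hS₀E g φ, hbound⟩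

/-! ### §4 The uniqueness criterion: approximation from the test space with vanishing commutator -/

/-- **Uniqueness criterion.**  Under Lions' hypotheses, let `u ∈ F` solve the homogeneous problem `E(u, φ) = 0` for all `φ`, and
suppose there are test elements `φₙ` with `j φₙ → u` and `E(u, φₙ) − E(j φₙ, φₙ) → 0`.  Then `u = 0`
(`α q(φₙ)² ≤ E(jφₙ, φₙ) = −(E(u, φₙ) − E(jφₙ, φₙ)) → 0`, so `‖j φₙ‖ ≤ C q(φₙ) → 0`).  This is the abstract form of the
«energy identity with cutoffs» argument. [cite: LionsMagenes1972, Chap. 3 Thm. 1.1 and Remark 1.3 (Lions' theorem)] -/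
theorem eq_zero_of_approx (j : Φ →ₗ[ℝ] F) (q : Φ → ℝ) (hq : ∀ φ, 0 ≤ q φ) {C : ℝ} (hC : 0 ≤ C)
    (hj : ∀ φ, ‖j φ‖ ≤ C * q φ) (E : F →ₗ[ℝ] Φ →ₗ[ℝ] ℝ) {α : ℝ} (hα : 0 < α) (hcoer : ∀ φ, α * q φ ^ 2 ≤ E (j φ) φ)
    {u : F} (hu : ∀ φ, E u φ = 0) {φs : ℕ → Φ} (hlim : Tendsto (fun n => j (φs n)) atTop (𝓝 u))
    (hcomm : Tendsto (fun n => E u (φs n) - E (j (φs n)) (φs n)) atTop (𝓝 0)) : u = 0 := by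
  -- `E(jφₙ, φₙ) → 0`
  have hdiag : Tendsto (fun n => E (j (φs n)) (φs n)) atTop (𝓝 0) := by
    have h := hcomm.neg
    rw [neg_zero] at h
    refine h.congr fun n => ?_
    rw [hu, zero_sub, neg_neg]
  -- `‖j φₙ‖ ≤ C q(φₙ) ≤ C √(E(jφₙ, φₙ)/α) → 0`
  have hsqrt : Tendsto (fun n => C * Real.sqrt (E (j (φs n)) (φs n) / α)) atTop (𝓝 0) := by
    have h1 : Tendsto (fun n => E (j (φs n)) (φs n) / α) atTop (𝓝 0) := by
      simpa using hdiag.div_const α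
    have h2 := (Real.continuous_sqrt.tendsto 0).comp h1
    rw [Real.sqrt_zero] at h2
    simpa using h2.const_mul C
  have hj0 : Tendsto (fun n => j (φs n)) atTop (𝓝 0) := by
    refine squeeze_zero_norm (fun n => ?_) hsqrt
    have hqle : q (φs n) ≤ Real.sqrt (E (j (φs n)) (φs n) / α) := by
      rw [← Real.sqrt_sq (hq (φs n))]
      exact Real.sqrt_le_sqrt (by rw [le_div_iff₀ hα, mul_comm]; exact hcoer (φs n))
    exact (hj (φs n)).trans (mul_le_mul_of_nonneg_left hqle hC)
  exact tendsto_nhds_unique hlim hj0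

/-- **Two weak solutions agree** under the uniqueness criterion for their difference. [cite: LionsMagenes1972, Chap. 3 Thm. 1.1 and Remark 1.3 (Lions' theorem)] -/
theorem eq_of_approx (j : Φ →ₗ[ℝ] F) (q : Φ → ℝ) (hq : ∀ φ, 0 ≤ q φ) {C : ℝ} (hC : 0 ≤ C)
    (hj : ∀ φ, ‖j φ‖ ≤ C * q φ) (E : F →ₗ[ℝ] Φ →ₗ[ℝ] ℝ) {α : ℝ} (hα : 0 < α) (hcoer : ∀ φ, α * q φ ^ 2 ≤ E (j φ) φ)
    (happrox : ∀ u : F, ∃ φs : ℕ → Φ, Tendsto (fun n => j (φs n)) atTop (𝓝 u) ∧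
      Tendsto (fun n => E u (φs n) - E (j (φs n)) (φs n)) atTop (𝓝 0))
    {u v : F} (h : ∀ φ, E u φ = E v φ) : u = v := by
  obtain ⟨φs, hlim, hcomm⟩ := happrox (u - v)
  have hu : ∀ φ, E (u - v) φ = 0 := fun φ => by rw [map_sub, LinearMap.sub_apply, h, sub_self]
  exact sub_eq_zero.1 (eq_zero_of_approx j q hq hC hj E hα hcoer hu hlim hcomm)

/-- **Under the criterion every weak solution is the canonical one**: if `S : W →L[ℝ] F` satisfies `E(S g, ·) = P g` (as produced by
`exists_solutionOperator_of_coercive`) and `u` is ANY weak solution with datum `g`, then `u = S g`. [cite: LionsMagenes1972, Chap. 3 Thm. 1.1 and Remark 1.3 (Lions' theorem)] -/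
theorem eq_solutionOperator_of_approx (j : Φ →ₗ[ℝ] F) (q : Φ → ℝ) (hq : ∀ φ, 0 ≤ q φ) {C : ℝ} (hC : 0 ≤ C)
    (hj : ∀ φ, ‖j φ‖ ≤ C * q φ) (E : F →ₗ[ℝ] Φ →ₗ[ℝ] ℝ) {α : ℝ} (hα : 0 < α) (hcoer : ∀ φ, α * q φ ^ 2 ≤ E (j φ) φ)
    (happrox : ∀ u : F, ∃ φs : ℕ → Φ, Tendsto (fun n => j (φs n)) atTop (𝓝 u) ∧
      Tendsto (fun n => E u (φs n) - E (j (φs n)) (φs n)) atTop (𝓝 0))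
    {W : Type*} [NormedAddCommGroup W] [NormedSpace ℝ W] (P : W →ₗ[ℝ] Φ →ₗ[ℝ] ℝ) (S : W →L[ℝ] F)
    (hS : ∀ g φ, E (S g) φ = P g φ) {g : W} {u : F} (hu : ∀ φ, E u φ = P g φ) : u = S g :=
  eq_of_approx j q hq hC hj E hα hcoer happrox fun φ => by rw [hu, hS]

/-- **A-priori bound for every weak solution** under the criterion: `E(u, ·) = P g` implies `‖u‖ ≤ C_P (C/α)‖g‖`
(existence of the canonical solution operator + uniqueness). [cite: LionsMagenes1972, Chap. 3 Thm. 1.1 and Remark 1.3 (Lions' theorem)] -/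
theorem norm_le_of_approx [CompleteSpace F] (j : Φ →ₗ[ℝ] F) (q : Φ → ℝ) (hq : ∀ φ, 0 ≤ q φ) {C : ℝ} (hC : 0 ≤ C)
    (hj : ∀ φ, ‖j φ‖ ≤ C * q φ) (E : F →ₗ[ℝ] Φ →ₗ[ℝ] ℝ) (hE : ∀ φ, ∃ K : ℝ, ∀ u, |E u φ| ≤ K * ‖u‖)
    {α : ℝ} (hα : 0 < α) (hcoer : ∀ φ, α * q φ ^ 2 ≤ E (j φ) φ)
    (happrox : ∀ u : F, ∃ φs : ℕ → Φ, Tendsto (fun n => j (φs n)) atTop (𝓝 u) ∧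
      Tendsto (fun n => E u (φs n) - E (j (φs n)) (φs n)) atTop (𝓝 0))
    {W : Type*} [NormedAddCommGroup W] [NormedSpace ℝ W] (P : W →ₗ[ℝ] Φ →ₗ[ℝ] ℝ) {CP : ℝ} (hCP : 0 ≤ CP)
    (hP : ∀ g φ, |P g φ| ≤ CP * ‖g‖ * q φ) {g : W} {u : F} (hu : ∀ φ, E u φ = P g φ) :
    ‖u‖ ≤ CP * (C / α) * ‖g‖ := by
  obtain ⟨S, hS, hSn⟩ := exists_solutionOperator_of_coercive j q hq hC hj E hE hα hcoer P hCP hP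
  rw [eq_solutionOperator_of_approx j q hq hC hj E hα hcoer happrox P S hS hu]
  exact hSn g

end Literature.Analysis.OperatorTheory

end
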